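import Literature.Computability.MetaComplexity.EFAdderLaws
import HarnessLib

/-!
# Subtraction and comparison in extended Frege: the complement-adder template

Layer C/3 of the `EF`-proof construction kit: subtraction and comparison of `w`-bit words by
the two's-complement adder `x + ¬y + 1 = x - y + 2ʷ` — its carry-out is `[x ≥ y]`, its sum
bits are `(x - y) mod 2ʷ` — as a template (`Sub.subT`, complement gates followed by an
embedded ripple adder with carry-in `1`), its views (`Sub.View`: base and the two operand
words; the inner adder view `View.adder`, difference bits `View.d`, comparison carries
`View.ge`), availability from instances and from embeddings (`Sub.avail_viewOf`,
`Sub.avail_viewEmb`, with `Netlist.embed_embed` flattening nested embeddings), and the first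
law: **subtract then add back** (`Sub.isBlock_subAddLines`): for an adder `E = d + y` on the
difference bits `d` of `x - y`, the sum bits of `E` are provably `x` and the carries of `E` are
provably the complements of the comparison carries (so `E` overflows iff `x < y`).
Comparison facts are represented downstream as the literal `¬ge` (`x < y`) / `ge` (`x ≥ y`)
of a subtractor instance.

## Sources

* S. A. Cook, R. A. Reckhow, *The relative efficiency of propositional proof systems*,
  J. Symbolic Logic 44 (1979), §2 (sound schematic rules).
* H. Vollmer, *Introduction to Circuit Complexity* (Springer 1999), §1.1–1.2 (subtraction by
  complement and increment; composition of circuits).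
-/

namespace Literature.Computability.MetaComplexity

open _root_.Computability Complexity Complexity.PropForm Netlist

namespace Sub

/-! ### The template: `x + ¬y + 1` -/

/-- The complement gates `¬yⱼ` (inputs `w + j`) of the `w`-bit subtractor. [cite: Vollmer1999, §1.1] -/
def notGates (w : ℕ) : Template := (List.range w).map fun j => ⟨Kind.not, [Sum.inl (w + j)]⟩

/-- The wiring of the embedded adder: first operand = the inputs `x`, second operand = the
complement gates. [folklore] -/
def wiring (w : ℕ) (i : ℕ) : ℕ ⊕ ℕ := if i < w then Sum.inl i else Sum.inr (i - w)

/-- **The subtractor / comparator template** on two `w`-bit inputs `x` (inputs `0…w-1`) and `y`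
(inputs `w…2w-1`): the complements `¬yⱼ` followed by a ripple adder with carry-in `1` computing
`x + ¬y + 1 = x - y + 2ʷ`; its carry-out (wire `3w`) is `[x ≥ y]` and its sum bits are
`(x - y) mod 2ʷ`. [cite: Vollmer1999, §1.1 (subtraction via two's complement)] -/
def subT (w : ℕ) : Template := notGates w ++ embed (Adder.addT true w) (wiring w) w

/-- Length of the complement part. [folklore] -/
@[simp] theorem length_notGates (w : ℕ) : (notGates w).length = w := by simp [notGates]

/-- Length of the subtractor. [folklore] -/
@[simp] theorem length_subT (w : ℕ) : (subT w).length = 3 * w + 1 := by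
  simp [subT]; ring

/-- The complement gates by index. [folklore] -/
theorem subT_not (w : ℕ) {j : ℕ} (hj : j < w) (h : j < (subT w).length) :
    (subT w)[j] = ⟨Kind.not, [Sum.inl (w + j)]⟩ := by
  apply Option.some_inj.1
  rw [← List.getElem?_eq_getElem h, subT, List.getElem?_append_left (by simpa using hj)]
  simp [notGates, hj]

/-- The embedded adder gates by index. [folklore] -/
theorem subT_emb (w : ℕ) {k : ℕ} (hk : k < (Adder.addT true w).length) :
    ∃ hk' : w + k < (subT w).length, (subT w)[w + k] =
      ⟨((Adder.addT true w)[k]).kind, ((Adder.addT true w)[k]).args.map (remap (wiring w) w)⟩ := by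
  have hk' : w + k < (subT w).length := by simp at hk ⊢; omega
  refine ⟨hk', Option.some_inj.1 ?_⟩
  rw [← List.getElem?_eq_getElem hk', subT, List.getElem?_append_right (by simp)]
  simp [embed, List.getElem?_eq_getElem hk]

/-- **The subtractor template is well formed** (`2w` inputs). [cite: Vollmer1999, §1.2] -/
theorem wf_subT (w : ℕ) : (subT w).WF (2 * w) := by
  intro k hk
  by_cases hkw : k < w
  · rw [subT_not w hkw]
    refine ⟨rfl, fun a ha => ?_⟩
    simp only [List.mem_singleton] at ha
    subst ha
    refine ⟨fun i hi => ?_, fun j hj => ?_⟩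
    · cases hi
      omega
    · cases hj
  · obtain ⟨k', rfl⟩ : ∃ k', k = w + k' := ⟨k - w, by omega⟩
    have hk' : k' < (Adder.addT true w).length := by simp at hk ⊢; omega
    obtain ⟨_, heq⟩ := subT_emb w hk'
    rw [heq]
    refine wf_embed_gate (Adder.wf_addT true w) (fun i hi => ?_) hk'
    unfold wiring
    split_ifs with h
    · refine ⟨fun i' hi' => ?_, fun j hj => ?_⟩
      · cases hi'
        omega
      · cases hj
    · refine ⟨fun i' hi' => ?_, fun j hj => ?_⟩
      · cases hi'
      · cases hj
        omega

/-! ### Views of a subtractor -/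

/-- A view of a `w`-bit subtractor: base of its gates and its operand words. [folklore] -/
structure View where
  /-- the first gate variable -/
  base : ℕ
  /-- the minuend bits -/
  x : ℕ → ℕ
  /-- the subtrahend bits -/
  y : ℕ → ℕ

namespace View

/-- The complement variable `¬yⱼ`. [folklore] -/
def ny (S : View) (j : ℕ) : ℕ := S.base + j

/-- The view of the inner adder `x + ¬y + 1` of a `w`-bit subtractor. [folklore] -/
def adder (S : View) (w : ℕ) : Adder.View := ⟨S.base + w, S.x, S.ny⟩

/-- The difference bit `dᵢ = ((x - y) mod 2ʷ)ᵢ`. [folklore] -/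
def d (S : View) (w i : ℕ) : ℕ := (S.adder w).s i

/-- The comparison carries: `geᵢ = [x mod 2ⁱ ≥ y mod 2ⁱ]`; `ge w = [x ≥ y]`. [folklore] -/
def ge (S : View) (w i : ℕ) : ℕ := (S.adder w).c i

/-- The definition line of the complement gate `j`. [folklore] -/
def notDef (S : View) (j : ℕ) : PropForm ℕ := biimp (var (S.ny j)) (neg (var (S.y j)))

/-- `S.Avail K Γ w`: the definition lines of the subtractor are available. [folklore] -/
def Avail (S : View) (K : PropForm ℕ) (Γ : Set (PropForm ℕ)) (w : ℕ) : Prop :=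
  (∀ j < w, ctx K (S.notDef j) ∈ Γ) ∧ (S.adder w).Avail K Γ true w

/-- Availability is monotone. [folklore] -/
theorem Avail.mono {S : View} {K : PropForm ℕ} {Γ Γ' : Set (PropForm ℕ)} {w : ℕ}
    (h : S.Avail K Γ w) (hΓ : Γ ⊆ Γ') : S.Avail K Γ' w :=
  ⟨fun j hj => hΓ (h.1 j hj), h.2.mono hΓ⟩

end View

/-- The view of a subtractor instance. [folklore] -/
def viewOf (P : Inst) (w : ℕ) : View :=
  ⟨P.base, fun i => P.inputs.getD i 0, fun i => P.inputs.getD (w + i) 0⟩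

/-- **A subtractor instance whose definitions are available provides an available view.**
[folklore] -/
theorem avail_viewOf {P : Inst} {K : PropForm ℕ} {Γ : Set (PropForm ℕ)} {w : ℕ}
    (hP : P.DefsAvail (subT w) K Γ) : (viewOf P w).Avail K Γ w := by
  refine ⟨fun j hj => ?_, ?_⟩
  · have h := hP j (by simp; omega)
    rwa [subT_not w hj] at h
  · have h := Adder.avail_viewEmb (c₀ := true) (W := w) (off := w) (w := wiring w) hP
      (fun k hk => subT_emb w hk)
    have hx : (fun i => P.ref (wiring w i)) = fun i => if i < w then P.inputs.getD i 0 else P.wire (i - w) := by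
      funext i
      unfold wiring
      split_ifs <;> rfl
    -- the adder view of the embedding coincides with `(viewOf P w).adder w` on the used bits
    refine ⟨?_, fun i hi => ⟨?_, ?_⟩⟩
    · simpa [Adder.viewEmb, viewOf, View.adder, Adder.View.cinDef, Adder.View.c,
        Adder.View.wire] using h.1
    · have := (h.2 i hi).1
      simpa [Adder.viewEmb, viewOf, View.adder, View.ny, Adder.View.sumDef, Adder.View.s,
        Adder.View.c, Adder.View.wire, wiring, hi, Inst.ref, Inst.wire] using this
    · have := (h.2 i hi).2
      simpa [Adder.viewEmb, viewOf, View.adder, View.ny, Adder.View.carryDef, Adder.View.s,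
        Adder.View.c, Adder.View.wire, wiring, hi, Inst.ref, Inst.wire] using this

/-- Nested embeddings flatten: embedding an embedded template re-wires through the outer wiring
and shifts by the outer offset. [cite: Vollmer1999, §1.2] -/
theorem _root_.Literature.Computability.MetaComplexity.Netlist.embed_embed (t : Template)
    (w₁ : ℕ → ℕ ⊕ ℕ) (o₁ : ℕ) (w₂ : ℕ → ℕ ⊕ ℕ) (o₂ : ℕ) :
    embed (embed t w₁ o₁) w₂ o₂ = embed t (fun i => remap w₂ o₂ (w₁ i)) (o₂ + o₁) := by
  simp only [embed, List.map_map]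
  refine List.map_congr_left fun g _ => ?_
  simp only [Function.comp_apply, List.map_map, TGate.mk.injEq, true_and]
  refine List.map_congr_left fun a _ => ?_
  cases a with
  | inl i => rfl
  | inr j => simp [remap, Nat.add_assoc]

/-- A general subtractor view inside an instance `I` of a template containing
`embed (subT w) wv off` at position `off`. [folklore] -/
def viewEmb (I : Inst) (wv : ℕ → ℕ ⊕ ℕ) (off w : ℕ) : View :=
  ⟨I.base + off, fun i => I.ref (wv i), fun i => I.ref (wv (w + i))⟩

/-- **An embedded subtractor provides an available view.** [folklore] -/
theorem avail_viewEmb {I : Inst} {t : Template} {K : PropForm ℕ} {Γ : Set (PropForm ℕ)} {w off : ℕ}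
    {wv : ℕ → ℕ ⊕ ℕ} (hI : I.DefsAvail t K Γ)
    (ht : ∀ (k : ℕ) (hk : k < (subT w).length), ∃ hk' : off + k < t.length,
      t[off + k] = ⟨((subT w)[k]).kind, ((subT w)[k]).args.map (remap wv off)⟩) :
    (viewEmb I wv off w).Avail K Γ w := by
  refine ⟨fun j hj => ?_, ?_⟩
  · obtain ⟨hk', heq⟩ := ht j (by simp; omega)
    have h := hI (off + j) hk'
    rw [heq, subT_not w hj] at h
    simpa [viewEmb, View.notDef, View.ny, Inst.body, Inst.wire, Kind.body, arg, remap, Nat.add_assoc]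
      using h
  · -- the inner adder is embedded with the composed wiring at offset `off + w`
    have hA := Adder.avail_viewEmb (c₀ := true) (W := w) (off := off + w)
      (w := fun i => remap wv off (wiring w i)) hI (fun k hk => by
        obtain ⟨hk₁, heq₁⟩ := subT_emb w hk
        obtain ⟨hk₂, heq₂⟩ := ht (w + k) hk₁
        refine ⟨by omega, ?_⟩
        have e : off + w + k = off + (w + k) := by omega
        simp only [e]
        rw [heq₂, heq₁]
        simp only [List.map_map, TGate.mk.injEq, true_and]
        refine List.map_congr_left fun a _ => ?_
        cases a with
        | inl i => rfl
        | inr j => simp [remap, Nat.add_assoc])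
    refine hA.congr (by simp [Adder.viewEmb, viewEmb, View.adder, Nat.add_assoc]) (fun i hi => ?_)
      (fun i hi => ?_)
    · simp [Adder.viewEmb, viewEmb, View.adder, wiring, remap, hi]
    · simp [Adder.viewEmb, viewEmb, View.adder, View.ny, wiring, remap, Inst.ref, Inst.wire, Nat.add_assoc]

/-! ### Rules of the subtractor layer -/

/-- Complementary carry-ins: `g ↔ ⊥`, `g' ↔ ⊤` give `g ↔ ¬g'`. [cite: CookReckhow1979, §2 (sound rule)] -/
def rCinNeg : FregeRule :=
  ⟨[ctx (var 0) (biimp (var 1) (const false)), ctx (var 0) (biimp (var 2) (const true))],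
   ctx (var 0) (biimp (var 1) (neg (var 2)))⟩

/-- The sum step of the subtract–add inverse law: with `n ↔ ¬y`, `d = x ⊕ n ⊕ c`,
`e = d' ⊕ y' ⊕ k`, `d' ↔ d`, `y' ↔ y`, `k ↔ ¬c`, infer `e ↔ x`.
[cite: CookReckhow1979, §2 (sound rule)] -/
def rSubAddSum : FregeRule :=
  ⟨[ctx (var 0) (biimp (var 1) (neg (var 2))),
    ctx (var 0) (biimp (var 3) (xor3F (var 4) (var 1) (var 5))),
    ctx (var 0) (biimp (var 6) (xor3F (var 7) (var 8) (var 9))),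
    ctx (var 0) (eqv 7 3), ctx (var 0) (eqv 8 2), ctx (var 0) (biimp (var 9) (neg (var 5)))],
   ctx (var 0) (eqv 6 4)⟩

/-- The carry step of the subtract–add inverse law: with `n ↔ ¬y`, `c⁺ = maj(x, n, c)`,
`d = x ⊕ n ⊕ c`, `k⁺ = maj(d', y', k)`, `d' ↔ d`, `y' ↔ y`, `k ↔ ¬c`, infer `k⁺ ↔ ¬c⁺`.
[cite: CookReckhow1979, §2 (sound rule)] -/
def rSubAddCarry : FregeRule :=
  ⟨[ctx (var 0) (biimp (var 1) (neg (var 2))),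
    ctx (var 0) (biimp (var 3) (majF (var 4) (var 1) (var 5))),
    ctx (var 0) (biimp (var 6) (xor3F (var 4) (var 1) (var 5))),
    ctx (var 0) (biimp (var 7) (majF (var 8) (var 9) (var 10))),
    ctx (var 0) (eqv 8 6), ctx (var 0) (eqv 9 2), ctx (var 0) (biimp (var 10) (neg (var 5)))],
   ctx (var 0) (biimp (var 7) (neg (var 3)))⟩

/-- The rules of the subtractor layer. [cite: CookReckhow1979, §2] -/
def rules : List FregeRule := [rCinNeg, rSubAddSum, rSubAddCarry]

/-- Every rule of the subtractor layer is sound (truth tables). [cite: CookReckhow1979, §2 (sound rule)] -/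
theorem isSound_of_mem_rules : ∀ r ∈ rules, r.IsSound := by
  intro r hr
  simp only [rules, List.mem_cons, List.not_mem_nil, or_false] at hr
  rcases hr with rfl | rfl | rfl <;> exact FregeRule.isSound_of_check (by decide +kernel)

/-- Membership of the subtractor rules in `rules`. [folklore] -/
theorem mem_rules : rCinNeg ∈ rules ∧ rSubAddSum ∈ rules ∧ rSubAddCarry ∈ rules := by
  simp [rules]

variable {G : FregeSystem} {K : PropForm ℕ} {Γ : Set (PropForm ℕ)} {w : ℕ}

/-! ### Law: adding back the subtrahend (`(x - y) + y = x`, carries complementary) -/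

/-- The lines of the subtract–add inverse law for a subtractor `S` (`x - y`) and an adder `E`
(`d + y`): line `2i` is `kᵢ ↔ ¬geᵢ` (the carries of `E` complement the comparison carries of
`S`), line `2i+1` is `eᵢ ↔ xᵢ` (the sum bits of `E` are the bits of `x`). [folklore] -/
def subAddLine (S : View) (E : Adder.View) (K : PropForm ℕ) (w k : ℕ) : PropForm ℕ :=
  if k % 2 = 0 then ctx K (biimp (var (E.c (k / 2))) (neg (var (S.ge w (k / 2)))))
  else ctx K (eqv (E.s (k / 2)) (S.x (k / 2)))

/-- The carry lines. [folklore] -/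
theorem subAddLine_even (S : View) (E : Adder.View) (K : PropForm ℕ) (w i : ℕ) :
    subAddLine S E K w (2 * i) = ctx K (biimp (var (E.c i)) (neg (var (S.ge w i)))) := by
  rw [subAddLine, if_pos (by omega), show 2 * i / 2 = i by omega]

/-- The sum lines. [folklore] -/
theorem subAddLine_odd (S : View) (E : Adder.View) (K : PropForm ℕ) (w i : ℕ) :
    subAddLine S E K w (2 * i + 1) = ctx K (eqv (E.s i) (S.x i)) := by
  rw [subAddLine, if_neg (by omega), show (2 * i + 1) / 2 = i by omega]

/-- The block of the subtract–add inverse law. [folklore] -/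
def subAddLines (S : View) (E : Adder.View) (K : PropForm ℕ) (w : ℕ) : List (PropForm ℕ) :=
  (List.range (2 * w + 1)).map (subAddLine S E K w)

/-- **Subtract then add back, inside Frege**: for a subtractor `S` on `(x, y)` (computing
`x + ¬y + 1`) and an adder `E` (carry-in `0`) whose operands are provably the difference bits
`dᵢ` of `S` and the bits `yᵢ`, the sum bits of `E` are provably `xᵢ` and its carries are the
complements of the comparison carries of `S` (so `E` overflows iff `x < y`): `2w + 1` local
inferences. [cite: CookReckhow1979, §2] -/
theorem isBlock_subAddLines (hG : ∀ r ∈ rules, r ∈ G.rules) (S : View) (E : Adder.View)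
    (hS : S.Avail K Γ w) (hE : E.Avail K Γ false w)
    (hd : ∀ i < w, ctx K (eqv (E.x i) (S.d w i)) ∈ Γ) (hy : ∀ i < w, ctx K (eqv (E.y i) (S.y i)) ∈ Γ) :
    G.IsBlock Γ (subAddLines S E K w) := by
  refine isBlock_map_range (2 * w + 1) fun k hk => Or.inr ?_
  rcases Adder.index_cases w k hk with rfl | ⟨i, hi, rfl | rfl⟩
  · -- the carry-ins `0` and `1`
    rw [show (0 : ℕ) = 2 * 0 from rfl, subAddLine_even]
    exact FregeSystem.IsInferredFrom.of_rule (hG _ mem_rules.1)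
      (FregeSystem.sub [K, var (E.c 0), var (S.ge w 0)]) rfl
      (FregeSystem.prems_cons (Or.inl hE.1) (FregeSystem.prems_cons (Or.inl hS.2.1)
        FregeSystem.prems_nil))
  · -- sum bit `i`
    rw [subAddLine_odd]
    exact FregeSystem.IsInferredFrom.of_rule (hG _ mem_rules.2.1)
      (FregeSystem.sub [K, var (S.ny i), var (S.y i), var (S.d w i), var (S.x i), var (S.ge w i),
        var (E.s i), var (E.x i), var (E.y i), var (E.c i)]) rfl
      (FregeSystem.prems_cons (Or.inl (hS.1 i hi)) (FregeSystem.prems_cons (Or.inl (hS.2.2 i hi).1)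
        (FregeSystem.prems_cons (Or.inl (hE.2 i hi).1) (FregeSystem.prems_cons (Or.inl (hd i hi))
        (FregeSystem.prems_cons (Or.inl (hy i hi)) (FregeSystem.prems_cons
        (Or.inr ⟨2 * i, by omega, (subAddLine_even S E K w i).symm⟩) FregeSystem.prems_nil))))))
  · -- carry `i + 1`
    rw [show 2 * i + 2 = 2 * (i + 1) by ring, subAddLine_even]
    exact FregeSystem.IsInferredFrom.of_rule (hG _ mem_rules.2.2)
      (FregeSystem.sub [K, var (S.ny i), var (S.y i), var (S.ge w (i + 1)), var (S.x i),
        var (S.ge w i), var (S.d w i), var (E.c (i + 1)), var (E.x i), var (E.y i), var (E.c i)]) rfl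
      (FregeSystem.prems_cons (Or.inl (hS.1 i hi)) (FregeSystem.prems_cons (Or.inl (hS.2.2 i hi).2)
        (FregeSystem.prems_cons (Or.inl (hS.2.2 i hi).1) (FregeSystem.prems_cons (Or.inl (hE.2 i hi).2)
        (FregeSystem.prems_cons (Or.inl (hd i hi)) (FregeSystem.prems_cons (Or.inl (hy i hi))
        (FregeSystem.prems_cons (Or.inr ⟨2 * i, by omega, (subAddLine_even S E K w i).symm⟩)
        FregeSystem.prems_nil)))))))

/-- The conclusions of the subtract–add inverse law: `eᵢ ↔ xᵢ`. [folklore] -/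
theorem sum_mem_subAddLines {S : View} {E : Adder.View} {K : PropForm ℕ} {w i : ℕ} (hi : i < w) :
    ctx K (eqv (E.s i) (S.x i)) ∈ subAddLines S E K w := by
  rw [← subAddLine_odd S E K w i]
  exact mem_map_range (by omega)

/-- The conclusions of the subtract–add inverse law: `kᵢ ↔ ¬geᵢ` (in particular the final carry
of `E` is `¬[x ≥ y]`). [folklore] -/
theorem carry_mem_subAddLines {S : View} {E : Adder.View} {K : PropForm ℕ} {w i : ℕ} (hi : i ≤ w) :
    ctx K (biimp (var (E.c i)) (neg (var (S.ge w i)))) ∈ subAddLines S E K w := by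
  rw [← subAddLine_even S E K w i]
  exact mem_map_range (by omega)

/-- Size of the subtract–add inverse law: `2w + 1` lines of size `≤ |K| + 12`. [folklore] -/
theorem proofSize_subAddLines (S : View) (E : Adder.View) (K : PropForm ℕ) (w : ℕ) :
    proofSize (subAddLines S E K w) ≤ (2 * w + 1) * (K.size + 12) :=
  proofSize_map_range_le fun k _ => by
    unfold subAddLine
    split_ifs <;> simp [ctx, eqv, size, FregeSystem.size_biimp]

end Sub

end Literature.Computability.MetaComplexity
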